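import Literature.Analysis.FluidPDE.PressureRepresentation
import Literature.Analysis.FluidPDE.SpaceTimeCalculus

/-!
# Crux `ScarRigidity` (stmt-NavierStokesRegularity-11717), line `moment-conditioned-rellich`:
# stub `stub_apexRegularity` — V: the polarised quadratic source of a time-derivative tower

Helper file (`--supports stmt-NavierStokesRegularity-11717`; theorems only, no definitions, no named
facts) for the registered stub `stub_apexRegularity` of line `moment-conditioned-rellich` (crux `ScarRigidity`,
route RellichScar): a Type-I ancient mild field `V` with the apex bound `‖V(t,x)‖ ≤ C/(‖x‖+√(−t))` is a classical
Navier–Stokes solution on `(−∞, 0)` with a pressure `Q` obeying the ALL-ORDERS scale-invariant package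
`‖∇ⁿV‖ ≤ L/(‖x‖+√(−t))^{1+n}`, `‖∇ⁿQ‖ ≤ L/(‖x‖+√(−t))^{2+n}`, `‖∂ₜ∇ⁿV‖ ≤ L/(‖x‖+√(−t))^{3+n}`; necessarily `Q` is
the Riesz pressure `Q[V(t)] = RᵢRⱼ(VᵢVⱼ)` (the tree's `pressurePotential`).  For the time
regularity of the Riesz pressure one differentiates its source `G[v(t)] = ∂ᵢ∂ⱼ(vᵢvⱼ) = tr D(Dv[v] + (div v) v)` in
time; this file records the polarised source `P_{bc}(t) = tr D(Du_c[u_b] + (tr Du_b) u_c)` of a tower of jointly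
smooth fields `u_b` with `∂ₜu_b = u_{b+1}`: it is jointly smooth (`isSmoothSpaceTimeOn_source`), equals
`pressureSource (u_b t)` on the diagonal (`source_diag_eq_pressureSource`), satisfies the recursion
`∂ₜP_{bc} = P_{b+1,c} + P_{b,c+1}` (`hasDerivAt_source`), and obeys the Leibniz bound
`‖DᵏP_{bc}‖ ≤ T(1+T)2^{k+2}B_bB_c` when `‖Dʲu_b‖ ≤ B_b`, `‖Dʲu_c‖ ≤ B_c` for `j ≤ k + 2` (`norm_iteratedFDeriv_source_le`,
the tree's `norm_iteratedFDeriv_pressureSource_le` polarised).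

## References

* G. Koch, N. Nadirashvili, G. Seregin, V. Šverák, Acta Math. 203 (2009) 83–105 = arXiv:0709.3599, §4 Prop. 4.1,
  §6. [KochNadirashviliSereginSverak2009]
* G. Seregin, V. Šverák, Comm. PDE 34 (2009) = arXiv:0804.1803, §2 p. 8. [SereginSverak2009]
* B. Pineau, V. Vicol, arXiv:2607.09619 (2026), Lemma 2.1, Lemma 7.1. [PineauVicol2026]
* D. Gilbarg, N. S. Trudinger, *Elliptic PDE of Second Order* (2001), Lemma 4.1–4.2. [GilbargTrudinger2001]
-/

noncomputable section

open MeasureTheory Set Function Filter Topology Metric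
open scoped ContDiff Laplacian

-- nested operator types (`ℝ³ →L[ℝ] ℝ³ →L[ℝ] ℝ³ →L[ℝ] ℝ`, `(X →L[ℝ] X [×n]→L[ℝ] F) →L[ℝ] X [×(n+1)]→L[ℝ] F`)
set_option maxSynthPendingDepth 4

namespace Summit.NavierStokesRegularity.NavierStokesRegularity.Theorems.RellichScarScarRigidity

open Literature.Analysis.FluidPDE

/-! ### The polarised quadratic source of a time-derivative tower -/

section Source

variable {W : Set ℝ} {u : ℕ → ℝ → (EuclideanSpace ℝ (Fin 3)) → (EuclideanSpace ℝ (Fin 3))}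

/-- **Joint smoothness of the polarised pre-source** `R_{bc}(t,x) = Du_c(t,x)[u_b(t,x)] + tr(Du_b(t,x)) u_c(t,x)` of a
tower of jointly smooth fields on an open time set. [folklore] -/
theorem isSmoothSpaceTimeOn_presource (hW : IsOpen W) (hu : ∀ b, IsSmoothSpaceTimeOn W (u b)) (b c : ℕ) :
    IsSmoothSpaceTimeOn W fun t x =>
      fderiv ℝ (u c t) x (u b t x) + traceCLM (fderiv ℝ (u b t) x) • u c t x := by
  have h1 : IsSmoothSpaceTimeOn W fun t x => fderiv ℝ (u c t) x (u b t x) :=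
    ContDiffOn.clm_apply ((hu c).isSmoothSpaceTimeOn_fderiv_of_isOpen hW) (hu b)
  have h2 : IsSmoothSpaceTimeOn W fun t x => traceCLM (fderiv ℝ (u b t) x) • u c t x :=
    (((hu b).isSmoothSpaceTimeOn_fderiv_of_isOpen hW).clm traceCLM).smul (hu c)
  exact ContDiffOn.add h1 h2

/-- **Joint smoothness of the polarised source** `P_{bc}(t,x) = tr D(R_{bc}(t,·))(x)`; for `b = c` and the field
`w = u_b(t)` this is the quadratic source `G[w] = ∂ᵢ∂ⱼ(wᵢwⱼ)` of the pressure Poisson equation. [folklore] -/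
theorem isSmoothSpaceTimeOn_source (hW : IsOpen W) (hu : ∀ b, IsSmoothSpaceTimeOn W (u b)) (b c : ℕ) :
    IsSmoothSpaceTimeOn W fun t x => traceCLM (fderiv ℝ (fun x' =>
      fderiv ℝ (u c t) x' (u b t x') + traceCLM (fderiv ℝ (u b t) x') • u c t x') x) :=
  ((isSmoothSpaceTimeOn_presource hW hu b c).isSmoothSpaceTimeOn_fderiv_of_isOpen hW).clm traceCLM

/-- The polarised source on the diagonal is the quadratic source `pressureSource`. [folklore] -/
theorem source_diag_eq_pressureSource (w : (EuclideanSpace ℝ (Fin 3)) → (EuclideanSpace ℝ (Fin 3))) :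
    (fun x => traceCLM (fderiv ℝ (fun x' => fderiv ℝ w x' (w x') + traceCLM (fderiv ℝ w x') • w x') x)) =
      pressureSource w := by
  rw [pressureSource_def, divergence_eq_traceCLM_comp]
  rfl

/-- **Time derivative of the pre-source along the tower**: if `∂ₜu_b = u_{b+1}` then
`∂ₜR_{bc} = R_{b+1,c} + R_{b,c+1}` (two product rules and the exchange `∂ₜDu = D∂ₜu`). [folklore] -/
theorem hasDerivAt_presource (hW : IsOpen W) (hu : ∀ b, IsSmoothSpaceTimeOn W (u b))
    (hdu : ∀ b, ∀ t ∈ W, ∀ y, HasDerivAt (fun s => u b s y) (u (b + 1) t y) t) (b c : ℕ) {t : ℝ}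
    (ht : t ∈ W) (x : EuclideanSpace ℝ (Fin 3)) :
    HasDerivAt (fun s => fderiv ℝ (u c s) x (u b s x) + traceCLM (fderiv ℝ (u b s) x) • u c s x)
      ((fderiv ℝ (u c t) x (u (b + 1) t x) + traceCLM (fderiv ℝ (u (b + 1) t) x) • u c t x) +
        (fderiv ℝ (u (c + 1) t) x (u b t x) + traceCLM (fderiv ℝ (u b t) x) • u (c + 1) t x)) t := by
  -- `∂ₜ Du_c = D u_{c+1}` (operator-valued exchange)
  have hD : ∀ c, HasDerivAt (fun s => fderiv ℝ (u c s) x) (fderiv ℝ (u (c + 1) t) x) t := by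
    intro c
    have h := (hu c).hasDerivAt_fderiv_slice_clm hW ht x
    have e : (fun y => deriv (fun s => u c s y) t) = u (c + 1) t := funext fun y => (hdu c t ht y).deriv
    rwa [e] at h
  have h1 : HasDerivAt (fun s => fderiv ℝ (u c s) x (u b s x))
      (fderiv ℝ (u (c + 1) t) x (u b t x) + fderiv ℝ (u c t) x (u (b + 1) t x)) t :=
    (hD c).clm_apply (hdu b t ht x)
  have htr : HasDerivAt (fun s => traceCLM (fderiv ℝ (u b s) x)) (traceCLM (fderiv ℝ (u (b + 1) t) x)) t :=
    (traceCLM : ((EuclideanSpace ℝ (Fin 3)) →L[ℝ] (EuclideanSpace ℝ (Fin 3))) →L[ℝ] ℝ).hasFDerivAt.comp_hasDerivAt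
      t (hD b)
  have h2 : HasDerivAt (fun s => traceCLM (fderiv ℝ (u b s) x) • u c s x)
      (traceCLM (fderiv ℝ (u b t) x) • u (c + 1) t x + traceCLM (fderiv ℝ (u (b + 1) t) x) • u c t x) t :=
    htr.smul (hdu c t ht x)
  refine (h1.add h2).congr_deriv ?_
  abel

/-- **Time derivative of the polarised source along the tower**: `∂ₜP_{bc} = P_{b+1,c} + P_{b,c+1}`. [folklore] -/
theorem hasDerivAt_source (hW : IsOpen W) (hu : ∀ b, IsSmoothSpaceTimeOn W (u b))
    (hdu : ∀ b, ∀ t ∈ W, ∀ y, HasDerivAt (fun s => u b s y) (u (b + 1) t y) t) (b c : ℕ) {t : ℝ}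
    (ht : t ∈ W) (x : EuclideanSpace ℝ (Fin 3)) :
    HasDerivAt (fun s => traceCLM (fderiv ℝ (fun x' =>
        fderiv ℝ (u c s) x' (u b s x') + traceCLM (fderiv ℝ (u b s) x') • u c s x') x))
      (traceCLM (fderiv ℝ (fun x' =>
        fderiv ℝ (u c t) x' (u (b + 1) t x') + traceCLM (fderiv ℝ (u (b + 1) t) x') • u c t x') x) +
       traceCLM (fderiv ℝ (fun x' =>
        fderiv ℝ (u (c + 1) t) x' (u b t x') + traceCLM (fderiv ℝ (u b t) x') • u (c + 1) t x') x)) t := by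
  set R : ℕ → ℕ → ℝ → (EuclideanSpace ℝ (Fin 3)) → (EuclideanSpace ℝ (Fin 3)) := fun b c s x' =>
    fderiv ℝ (u c s) x' (u b s x') + traceCLM (fderiv ℝ (u b s) x') • u c s x' with hR
  have hRs : ∀ b c, IsSmoothSpaceTimeOn W (R b c) := fun b c => isSmoothSpaceTimeOn_presource hW hu b c
  -- exchange for `R b c`
  have h := (hRs b c).hasDerivAt_fderiv_slice_clm hW ht x
  have e : (fun y => deriv (fun s => R b c s y) t) = R (b + 1) c t + R b (c + 1) t := by
    funext y
    exact (hasDerivAt_presource hW hu hdu b c ht y).deriv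
  rw [e] at h
  have hd1 : Differentiable ℝ (R (b + 1) c t) :=
    ((hRs (b + 1) c).contDiff_slice ht).differentiable (by simp)
  have hd2 : Differentiable ℝ (R b (c + 1) t) :=
    ((hRs b (c + 1)).contDiff_slice ht).differentiable (by simp)
  rw [fderiv_add (hd1 x) (hd2 x)] at h
  have h' := (traceCLM : ((EuclideanSpace ℝ (Fin 3)) →L[ℝ] (EuclideanSpace ℝ (Fin 3))) →L[ℝ] ℝ).hasFDerivAt.comp_hasDerivAt t h
  rw [map_add] at h'
  exact h'

/-- **Leibniz bounds for the polarised source**: if `‖Dʲu_b(t,x)‖ ≤ B_b`, `‖Dʲu_c(t,x)‖ ≤ B_c` for `j ≤ k + 2`,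
then `‖DᵏP_{bc}(t,x)‖ ≤ T(1+T) 2^{k+2} B_b B_c`, `T = ‖tr‖` (as the tree's `norm_iteratedFDeriv_pressureSource_le`,
polarised). [folklore] -/
theorem norm_iteratedFDeriv_source_le {w₁ w₂ : (EuclideanSpace ℝ (Fin 3)) → (EuclideanSpace ℝ (Fin 3))}
    (hw₁ : ContDiff ℝ ∞ w₁) (hw₂ : ContDiff ℝ ∞ w₂) (k : ℕ) {B₁ B₂ : ℝ} (hB₁ : 0 ≤ B₁) (hB₂ : 0 ≤ B₂)
    (x : EuclideanSpace ℝ (Fin 3))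
    (h₁ : ∀ j ≤ k + 2, ‖iteratedFDeriv ℝ j w₁ x‖ ≤ B₁) (h₂ : ∀ j ≤ k + 2, ‖iteratedFDeriv ℝ j w₂ x‖ ≤ B₂) :
    ‖iteratedFDeriv ℝ k (fun y => traceCLM (fderiv ℝ (fun x' =>
        fderiv ℝ w₂ x' (w₁ x') + traceCLM (fderiv ℝ w₁ x') • w₂ x') y)) x‖ ≤
      ‖(traceCLM : ((EuclideanSpace ℝ (Fin 3)) →L[ℝ] (EuclideanSpace ℝ (Fin 3))) →L[ℝ] ℝ)‖ *
        ((1 + ‖(traceCLM : ((EuclideanSpace ℝ (Fin 3)) →L[ℝ] (EuclideanSpace ℝ (Fin 3))) →L[ℝ] ℝ)‖) *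
          (2 ^ (k + 2) * (B₁ * B₂))) := by
  set T : ℝ := ‖(traceCLM : ((EuclideanSpace ℝ (Fin 3)) →L[ℝ] (EuclideanSpace ℝ (Fin 3))) →L[ℝ] ℝ)‖
    with hT
  have hT0 : 0 ≤ T := norm_nonneg _
  have hD1 : ContDiff ℝ ∞ (fderiv ℝ w₁) := hw₁.fderiv_right (m := ∞) le_rfl
  have hD2 : ContDiff ℝ ∞ (fderiv ℝ w₂) := hw₂.fderiv_right (m := ∞) le_rfl
  have hdiv : ContDiff ℝ ∞ (fun y => traceCLM (fderiv ℝ w₁ y)) :=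
    (traceCLM : ((EuclideanSpace ℝ (Fin 3)) →L[ℝ] (EuclideanSpace ℝ (Fin 3))) →L[ℝ] ℝ).contDiff.comp hD1
  have hconv : ContDiff ℝ ∞ (fun y => fderiv ℝ w₂ y (w₁ y)) := hD2.clm_apply hw₁
  have hsm : ContDiff ℝ ∞ (fun y => traceCLM (fderiv ℝ w₁ y) • w₂ y) := hdiv.smul hw₂
  set Rf : (EuclideanSpace ℝ (Fin 3)) → (EuclideanSpace ℝ (Fin 3)) :=
    fun x' => fderiv ℝ w₂ x' (w₁ x') + traceCLM (fderiv ℝ w₁ x') • w₂ x' with hRf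
  have hRs : ContDiff ℝ ∞ Rf := hconv.add hsm
  have hG : (fun y => traceCLM (fderiv ℝ Rf y)) = traceCLM ∘ fderiv ℝ Rf := rfl
  -- derivative bounds in the needed ranges
  have hD2j : ∀ i ∈ Finset.range (k + 2), ‖iteratedFDeriv ℝ i (fderiv ℝ w₂) x‖ ≤ B₂ := by
    intro i hi
    rw [norm_iteratedFDeriv_fderiv]
    exact h₂ (i + 1) (by have := Finset.mem_range.1 hi; omega)
  have hw1j : ∀ i ∈ Finset.range (k + 2), ‖iteratedFDeriv ℝ (k + 1 - i) w₁ x‖ ≤ B₁ := fun i hi =>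
    h₁ (k + 1 - i) (by omega)
  have hw2j : ∀ i ∈ Finset.range (k + 2), ‖iteratedFDeriv ℝ (k + 1 - i) w₂ x‖ ≤ B₂ := fun i hi =>
    h₂ (k + 1 - i) (by omega)
  have hdivj : ∀ i ∈ Finset.range (k + 2), ‖iteratedFDeriv ℝ i (fun y => traceCLM (fderiv ℝ w₁ y)) x‖ ≤ T * B₁ := by
    intro i hi
    calc ‖iteratedFDeriv ℝ i (fun y => traceCLM (fderiv ℝ w₁ y)) x‖ ≤ T * ‖iteratedFDeriv ℝ i (fderiv ℝ w₁) x‖ :=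
          ContinuousLinearMap.norm_iteratedFDeriv_comp_left _ hD1.contDiffAt (by exact_mod_cast le_top)
      _ ≤ T * B₁ := by
          refine mul_le_mul_of_nonneg_left ?_ hT0
          rw [norm_iteratedFDeriv_fderiv]
          exact h₁ (i + 1) (by have := Finset.mem_range.1 hi; omega)
  have hsum : ∑ i ∈ Finset.range (k + 1 + 1), ((k + 1).choose i : ℝ) = 2 ^ (k + 1) := by
    have := Nat.sum_range_choose (k + 1); exact_mod_cast this
  -- (a) the convective term
  have ha : ‖iteratedFDeriv ℝ (k + 1) (fun y => fderiv ℝ w₂ y (w₁ y)) x‖ ≤ 2 ^ (k + 1) * (B₂ * B₁) := by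
    refine (norm_iteratedFDeriv_clm_apply hD2 hw₁ x (by exact_mod_cast le_top)).trans ?_
    calc ∑ i ∈ Finset.range (k + 1 + 1), ((k + 1).choose i : ℝ) *
          ‖iteratedFDeriv ℝ i (fderiv ℝ w₂) x‖ * ‖iteratedFDeriv ℝ (k + 1 - i) w₁ x‖
        ≤ ∑ i ∈ Finset.range (k + 1 + 1), ((k + 1).choose i : ℝ) * B₂ * B₁ :=
          Finset.sum_le_sum fun i hi =>
            mul_le_mul (mul_le_mul_of_nonneg_left (hD2j i hi) (Nat.cast_nonneg _)) (hw1j i hi)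
              (norm_nonneg _) (mul_nonneg (Nat.cast_nonneg _) hB₂)
      _ = 2 ^ (k + 1) * (B₂ * B₁) := by rw [← Finset.sum_mul, ← Finset.sum_mul, hsum]; ring
  -- (b) the compressible term
  have hb : ‖iteratedFDeriv ℝ (k + 1) (fun y => traceCLM (fderiv ℝ w₁ y) • w₂ y) x‖ ≤
      2 ^ (k + 1) * (T * B₁) * B₂ := by
    refine (norm_iteratedFDeriv_smul_le hdiv hw₂ x (by exact_mod_cast le_top)).trans ?_
    calc ∑ i ∈ Finset.range (k + 1 + 1), ((k + 1).choose i : ℝ) *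
          ‖iteratedFDeriv ℝ i (fun y => traceCLM (fderiv ℝ w₁ y)) x‖ * ‖iteratedFDeriv ℝ (k + 1 - i) w₂ x‖
        ≤ ∑ i ∈ Finset.range (k + 1 + 1), ((k + 1).choose i : ℝ) * (T * B₁) * B₂ :=
          Finset.sum_le_sum fun i hi =>
            mul_le_mul (mul_le_mul_of_nonneg_left (hdivj i hi) (Nat.cast_nonneg _)) (hw2j i hi)
              (norm_nonneg _) (mul_nonneg (Nat.cast_nonneg _) (mul_nonneg hT0 hB₁))
      _ = 2 ^ (k + 1) * (T * B₁) * B₂ := by rw [← Finset.sum_mul, ← Finset.sum_mul, hsum]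
  have hRk : ‖iteratedFDeriv ℝ (k + 1) Rf x‖ ≤ 2 ^ (k + 1) * (B₂ * B₁) + 2 ^ (k + 1) * (T * B₁) * B₂ := by
    have eR : Rf = (fun y => fderiv ℝ w₂ y (w₁ y)) + fun y => traceCLM (fderiv ℝ w₁ y) • w₂ y := rfl
    rw [eR, iteratedFDeriv_add_apply (hconv.of_le (by exact_mod_cast le_top)).contDiffAt
      (hsm.of_le (by exact_mod_cast le_top)).contDiffAt]
    exact (norm_add_le _ _).trans (add_le_add ha hb)
  rw [hG]
  calc ‖iteratedFDeriv ℝ k (traceCLM ∘ fderiv ℝ Rf) x‖ ≤ T * ‖iteratedFDeriv ℝ k (fderiv ℝ Rf) x‖ :=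
        ContinuousLinearMap.norm_iteratedFDeriv_comp_left _
          (hRs.fderiv_right (m := ∞) le_rfl).contDiffAt (by exact_mod_cast le_top)
    _ = T * ‖iteratedFDeriv ℝ (k + 1) Rf x‖ := by rw [norm_iteratedFDeriv_fderiv]
    _ ≤ T * (2 ^ (k + 1) * (B₂ * B₁) + 2 ^ (k + 1) * (T * B₁) * B₂) := mul_le_mul_of_nonneg_left hRk hT0
    _ = T * ((1 + T) * (2 ^ (k + 1) * (B₁ * B₂))) := by ring
    _ ≤ T * ((1 + T) * (2 ^ (k + 2) * (B₁ * B₂))) := by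
        have h2 : (2 : ℝ) ^ (k + 1) ≤ 2 ^ (k + 2) := pow_le_pow_right₀ (by norm_num) (by omega)
        have : 0 ≤ T * (1 + T) * (B₁ * B₂) := by positivity
        nlinarith

end Source


/-- **Registered sub-goal `stub_apexRegSourcePolarisation` of `stub_apexRegularity`**: the polarised source on the
diagonal is the quadratic source of the pressure Poisson equation (`source_diag_eq_pressureSource`). [folklore] -/
theorem stub_apexRegSourcePolarisation :
    ∀ w : EuclideanSpace ℝ (Fin 3) → EuclideanSpace ℝ (Fin 3), (fun x => traceCLM (fderiv ℝ (fun x' =>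
      fderiv ℝ w x' (w x') + traceCLM (fderiv ℝ w x') • w x') x)) = pressureSource w :=
  fun w => source_diag_eq_pressureSource w

end Summit.NavierStokesRegularity.NavierStokesRegularity.Theorems.RellichScarScarRigidity

end
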